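import Literature.NumberTheory.Sieve.SmoothSaddleKernel
import HarnessLib

/-!
# The saddle-point method on `Re s = α(x,y)` with a parametric Gaussian window

Topic `Literature/NumberTheory/Sieve`; a PROVED tool file generalising `SmoothSaddleKernel`
([HildebrandTenenbaum1986, §4 (Lemmas 10–11)], [Harper2016, §5]). With `α = α(x,y)`, `φ = φ₂(α,y)`,
`e(t)` the saddle exponent and `f_A(t) = exp(e(t)) A(t)` for an abstract kernel `A`, the file
`SmoothSaddleKernel` estimates `∫ f_A − A(0)√(2π/φ)` off and on the HARD-WIRED window `τ = 100/√φ`,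
which leaves two fixed relative floors `‖A 0‖ e^{−2500} √(4π/φ)` and `B₀ e^{−72} √(125π³/φ)` in
`SaddleKernel.norm_kernelIntegral_sub_main_le`. Here the window is `τ = W/√φ` for a real PARAMETER
`W > 0`, and both floors become Gaussian in `W`:

* `norm_tailIntegral_le_window`:
  `‖∫_{[-τ,τ]ᶜ} f_A‖ ≤ B₀ e^{−W²/140} √(125π³/φ) + 10π ε₁ B₀/α + 2π ε₂ B_a T + 2π B₃/T²`;
* `norm_kernelIntegral_sub_main_le_window`:
  `‖∫ f_A − A(0)√(2π/φ)‖ ≤ (1475 B₀ log y + 4B₁)/φ + ‖A 0‖ e^{−W²/4} √(4π/φ) + B₀ e^{−W²/140} √(125π³/φ)`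
  `+ 10π ε₁ B₀/α + 2π ε₂ B_a T + 2π B₃/T²`,

under the hypotheses of the originals with `100/√φ` replaced by `W/√φ` (`W/√φ ≤ π/log y ≤ 1`,
`13 (W/√φ)³ log y φ ≤ 1`, decay `≤ ε₁`, `≤ ε₂` of `ζ(α+it,y)/ζ(α,y)` on `π/log y ≤ |t| ≤ 3`, `3 ≤ |t| ≤ T`).
The proofs are those of `SmoothSaddleKernel` verbatim, with the Gaussian rate `bτ² = 2W²/(25π²) ≥ W²/126`
(`b = 2φ/(25π²)`) in place of `800/π² ≥ 80`. Choosing `W = W(ε)` afterwards makes every error an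
`ε`-fraction of the main term (`SmoothTwistedSaddleWindow`, `SmoothTwistedSaddleWindowRange`), which is what
the matching of friable key-cell laws to ARBITRARY relative precision needs. Also here, for that choice:
`window_floor_le` (both floors are `≤ (5/2)δ` once `W ≥ 100`, `Wδ ≥ 80`) and `window_range` (the two
window hypotheses hold as soon as `169 W⁶/c ≤ r⁴`, `r⁵ = log x`, `log y ≤ r`, `φ ≥ c log x log y`).

## References

* A. Hildebrand, G. Tenenbaum, Trans. AMS 296 (1986), §4 (Lemmas 10–11) [HildebrandTenenbaum1986].
* A. J. Harper, Compositio Math. 152 (2016), §5 [Harper2016].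
-/

noncomputable section

open Real Complex MeasureTheory Set Filter
open scoped Topology

namespace Literature.NumberTheory.Sieve

namespace SaddleKernel

/-! ### The tails off a window of width `W/√φ` -/

set_option maxHeartbeats 1000000 in
/-- **The tails off a parametric window** (abstract kernel). Let `α = α(x,y) ∈ [3/5,1]`, `φ = φ₂(α,y) > 0`,
`W > 0`, `τ = W/√φ ≤ π/log y ≤ 1`, suppose the decay of `ζ(α+it,y)/ζ(α,y)`: `≤ ε₁` for `π/log y ≤ |t| ≤ 3`
and `≤ ε₂` for `3 ≤ |t| ≤ T` (`T ≥ 3`), and a continuous integrable kernel with `‖A t‖ ≤ B₀` (`|t| ≤ 3`),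
`‖A t‖ ≤ B_a` (all `t`), `‖A t‖ ≤ B₃/|t|³` (`|t| > T`). Then
`‖∫_{[-τ,τ]ᶜ} f_A‖ ≤ B₀ e^{−W²/140} √(125π³/φ) + 10π ε₁ B₀/α + 2π ε₂ B_a T + 2π B₃/T²`
(`W = 100` is `norm_tailIntegral_le` up to `e^{−500/7} ≤ e^{−71}` in place of `e^{−72}`).
[cite: HildebrandTenenbaum1986, §4 (Lemma 10)] -/
theorem norm_tailIntegral_le_window {x T ε₁ ε₂ B₀ Ba B₃ W : ℝ} {y : ℕ} {A : ℝ → ℂ} (hy : 2 ≤ y)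
    (hα : 3 / 5 ≤ saddlePoint x y) (hα1 : saddlePoint x y ≤ 1) (hφ0 : 0 < saddlePhi₂ (saddlePoint x y) y)
    (hW : 0 < W) (hτ : W / Real.sqrt (saddlePhi₂ (saddlePoint x y) y) ≤ Real.pi / Real.log y)
    (hy1 : Real.pi / Real.log y ≤ 1) (hT : 3 ≤ T) (hε₁ : 0 ≤ ε₁) (hε₂ : 0 ≤ ε₂)
    (hdec1 : ∀ t : ℝ, Real.pi / Real.log y ≤ |t| → |t| ≤ 3 →
      ‖smoothZetaC ((saddlePoint x y : ℂ) + t * I) y‖ / smoothZeta (saddlePoint x y) y ≤ ε₁)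
    (hdec2 : ∀ t : ℝ, 3 ≤ |t| → |t| ≤ T →
      ‖smoothZetaC ((saddlePoint x y : ℂ) + t * I) y‖ / smoothZeta (saddlePoint x y) y ≤ ε₂)
    (hA : Continuous A) (hAi : Integrable A) (hB₀ : 0 ≤ B₀) (hBa : 0 ≤ Ba) (hB₃ : 0 ≤ B₃)
    (hB0 : ∀ t : ℝ, |t| ≤ 3 → ‖A t‖ ≤ B₀) (hBall : ∀ t : ℝ, ‖A t‖ ≤ Ba)
    (hB3 : ∀ t : ℝ, T < |t| → ‖A t‖ ≤ B₃ / |t| ^ 3) :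
    ‖∫ t in (Icc (-(W / Real.sqrt (saddlePhi₂ (saddlePoint x y) y))) (W / Real.sqrt (saddlePhi₂ (saddlePoint x y) y)))ᶜ,
        kernelIntegrand x (saddlePoint x y) y A t‖ ≤
      B₀ * Real.exp (-(W ^ 2 / 140)) * Real.sqrt (125 * Real.pi ^ 3 / saddlePhi₂ (saddlePoint x y) y) +
        10 * Real.pi * ε₁ * B₀ / saddlePoint x y + 2 * Real.pi * ε₂ * Ba * T + 2 * Real.pi * B₃ / T ^ 2 := by
  set α : ℝ := saddlePoint x y with hαdef
  have hα0 : 0 < α := by linarith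
  set φ : ℝ := saddlePhi₂ α y with hφ
  set Φ : ℝ := Real.sqrt φ with hΦ
  have hΦ0 : 0 < Φ := Real.sqrt_pos.mpr hφ0
  have hΦsq : Φ ^ 2 = φ := Real.sq_sqrt hφ0.le
  set τ : ℝ := W / Φ with hτdef
  have hτ0 : 0 < τ := by positivity
  have hτ1 : τ ≤ 1 := hτ.trans hy1
  have hlogy0 : 0 < Real.log y := Real.log_pos (by exact_mod_cast lt_of_lt_of_le one_lt_two hy)
  have hT0 : 0 < T := by linarith
  -- the Gaussian rate `b = 2φ/(25π²)`: `bτ² = 2W²/(25π²) ≥ W²/126`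
  set b : ℝ := 2 / (25 * Real.pi ^ 2) * φ with hb
  have hb0 : 0 < b := by have := Real.pi_pos; positivity
  have hbτ : b * τ ^ 2 = 2 * W ^ 2 / (25 * Real.pi ^ 2) := by
    rw [hb, hτdef, div_pow, hΦsq]; field_simp
  have hbτW : W ^ 2 / 126 ≤ b * τ ^ 2 := by
    have hπ2 : Real.pi ^ 2 ≤ 10 := by have := Real.pi_lt_d2; nlinarith [Real.pi_pos]
    rw [hbτ, div_le_div_iff₀ (by norm_num) (by positivity)]
    nlinarith [hπ2, sq_nonneg W]
  set A' : ℝ := B₀ * Real.exp (-(W ^ 2 / 140)) with hA'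
  have hA'0 : 0 ≤ A' := by positivity
  set B : ℝ := ε₁ * B₀ * (α ^ 2 + 9) with hB
  have hB0' : 0 ≤ B := by positivity
  set C : ℝ := 2 * ε₂ * Ba * T ^ 2 + 2 * B₃ / T with hC
  have hC0 : 0 ≤ C := by positivity
  -- ### the pointwise majorant off the window
  have hmaj : ∀ t, t ∉ Icc (-τ) τ → ‖kernelIntegrand x α y A t‖ ≤
      A' * Real.exp (-(b / 10) * t ^ 2) + B / (α ^ 2 + t ^ 2) + C / (T ^ 2 + t ^ 2) := by
    intro t ht
    have htabs : τ < |t| := by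
      rw [mem_Icc, not_and_or, not_le, not_le] at ht
      rcases ht with h | h
      · rw [abs_of_neg (by linarith)]; linarith
      · exact lt_of_lt_of_le h (le_abs_self t)
    have hnorm : ‖kernelIntegrand x α y A t‖ =
        ‖smoothZetaC ((α : ℂ) + t * I) y‖ / smoothZeta α y * ‖A t‖ := norm_kernelIntegrand_eq hα0 x y A t
    have hratio1 : ‖smoothZetaC ((α : ℂ) + t * I) y‖ / smoothZeta α y ≤ 1 := by
      rw [div_le_one (smoothZeta_pos hα0)]; exact norm_smoothZetaC_le hα0 t y
    have h3terms : 0 ≤ A' * Real.exp (-(b / 10) * t ^ 2) ∧ 0 ≤ B / (α ^ 2 + t ^ 2) ∧ 0 ≤ C / (T ^ 2 + t ^ 2) :=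
      ⟨by positivity, by positivity, by positivity⟩
    rcases le_or_gt |t| (Real.pi / Real.log y) with hI | hI
    · ---- region E4: `τ < |t| ≤ π/log y`: Gaussian decay of `ζ`, `‖A‖ ≤ B₀`
      have hgauss := norm_smoothZetaC_le_mul_exp_gaussian (le_trans (by norm_num) hα) (t := t) (y := y)
        (by rw [le_div_iff₀ hlogy0] at hI; linarith)
      have hAt : ‖A t‖ ≤ B₀ := hB0 t (hI.trans (hy1.trans (by norm_num)))
      -- the exponent is `-b t²` exactly (`φ₂` is that sum)
      have hexpo : -(2 / (25 * Real.pi ^ 2)) * t ^ 2 *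
          ∑ p ∈ Nat.primesLE y, Real.log p ^ 2 * ((p : ℝ) ^ α / ((p : ℝ) ^ α - 1) ^ 2) = -b * t ^ 2 := by
        rw [hb, hφ, saddlePhi₂]; ring
      rw [hexpo] at hgauss
      have hrat : ‖smoothZetaC ((α : ℂ) + t * I) y‖ / smoothZeta α y ≤ Real.exp (-b * t ^ 2) := by
        rw [div_le_iff₀ (smoothZeta_pos hα0)]
        have := mul_comm (smoothZeta α y) (Real.exp (-b * t ^ 2))
        linarith
      -- `e^{-bt²} ≤ e^{-W²/140} e^{-(b/10)t²}` for `|t| ≥ τ` (`(9/10) b τ² ≥ (9/10) W²/126 = W²/140`)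
      have hsplit : Real.exp (-b * t ^ 2) ≤ Real.exp (-(W ^ 2 / 140)) * Real.exp (-(b / 10) * t ^ 2) := by
        rw [← Real.exp_add]
        apply Real.exp_le_exp.mpr
        have ht2 : τ ^ 2 ≤ t ^ 2 := by
          have h := pow_le_pow_left₀ hτ0.le htabs.le 2
          rwa [sq_abs] at h
        have hbt : b * τ ^ 2 ≤ b * t ^ 2 := mul_le_mul_of_nonneg_left ht2 hb0.le
        linarith
      calc ‖kernelIntegrand x α y A t‖ = ‖smoothZetaC ((α : ℂ) + t * I) y‖ / smoothZeta α y * ‖A t‖ := hnorm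
        _ ≤ (Real.exp (-(W ^ 2 / 140)) * Real.exp (-(b / 10) * t ^ 2)) * B₀ :=
            mul_le_mul (hrat.trans hsplit) hAt (norm_nonneg _) (by positivity)
        _ = A' * Real.exp (-(b / 10) * t ^ 2) := by rw [hA']; ring
        _ ≤ A' * Real.exp (-(b / 10) * t ^ 2) + B / (α ^ 2 + t ^ 2) + C / (T ^ 2 + t ^ 2) := by
            linarith [h3terms.2.1, h3terms.2.2]
    · rcases le_or_gt |t| 3 with hII | hII
      · ---- region E5: `π/log y < |t| ≤ 3`
        have hrat := hdec1 t hI.le hII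
        have hAt : ‖A t‖ ≤ B₀ := hB0 t hII
        have hden : 1 ≤ (α ^ 2 + 9) / (α ^ 2 + t ^ 2) := by
          rw [le_div_iff₀ (by positivity)]
          have h9 : t ^ 2 ≤ 3 ^ 2 := by
            have h := pow_le_pow_left₀ (abs_nonneg t) hII 2
            rwa [sq_abs] at h
          linarith
        calc ‖kernelIntegrand x α y A t‖ = ‖smoothZetaC ((α : ℂ) + t * I) y‖ / smoothZeta α y * ‖A t‖ := hnorm
          _ ≤ ε₁ * B₀ := mul_le_mul hrat hAt (norm_nonneg _) hε₁
          _ ≤ ε₁ * B₀ * ((α ^ 2 + 9) / (α ^ 2 + t ^ 2)) :=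
              le_mul_of_one_le_right (by positivity) hden
          _ = B / (α ^ 2 + t ^ 2) := by rw [hB]; field_simp
          _ ≤ A' * Real.exp (-(b / 10) * t ^ 2) + B / (α ^ 2 + t ^ 2) + C / (T ^ 2 + t ^ 2) := by
              linarith [h3terms.1, h3terms.2.2]
      · rcases le_or_gt |t| T with hIII | hIII
        · ---- region E6: `3 < |t| ≤ T`
          have hrat := hdec2 t hII.le hIII
          have hAt : ‖A t‖ ≤ Ba := hBall t
          have hden : 1 ≤ 2 * T ^ 2 / (T ^ 2 + t ^ 2) := by
            rw [le_div_iff₀ (by positivity)]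
            have h9 : t ^ 2 ≤ T ^ 2 := by
              have h := pow_le_pow_left₀ (abs_nonneg t) hIII 2
              rwa [sq_abs] at h
            linarith
          calc ‖kernelIntegrand x α y A t‖ = ‖smoothZetaC ((α : ℂ) + t * I) y‖ / smoothZeta α y * ‖A t‖ := hnorm
            _ ≤ ε₂ * Ba := mul_le_mul hrat hAt (norm_nonneg _) hε₂
            _ ≤ ε₂ * Ba * (2 * T ^ 2 / (T ^ 2 + t ^ 2)) := le_mul_of_one_le_right (by positivity) hden
            _ ≤ C / (T ^ 2 + t ^ 2) := by
                rw [← mul_div_assoc]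
                apply div_le_div_of_nonneg_right _ (by positivity)
                rw [hC]
                have : 0 ≤ 2 * B₃ / T := by positivity
                nlinarith
            _ ≤ A' * Real.exp (-(b / 10) * t ^ 2) + B / (α ^ 2 + t ^ 2) + C / (T ^ 2 + t ^ 2) := by
                linarith [h3terms.1, h3terms.2.1]
        · ---- region E7: `|t| > T`: the decay of `A`
          have hAt : ‖A t‖ ≤ B₃ / |t| ^ 3 := hB3 t hIII
          have hden : B₃ / |t| ^ 3 ≤ (2 * B₃ / T) / (T ^ 2 + t ^ 2) := by
            -- `B₃ (T² + t²) T ≤ 2 B₃ |t|³` since `T² + t² ≤ 2t²` and `T t² ≤ |t| t²`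
            have ht2 : T ^ 2 ≤ t ^ 2 := by
              have h := pow_le_pow_left₀ hT0.le hIII.le 2
              rwa [sq_abs] at h
            have h1 : |t| ^ 3 = |t| * t ^ 2 := by rw [← sq_abs]; ring
            have h2 : T * (T ^ 2 + t ^ 2) ≤ 2 * (|t| * t ^ 2) := by
              nlinarith [mul_le_mul hIII.le ht2 (by positivity) (abs_nonneg t),
                mul_le_mul_of_nonneg_right hIII.le (sq_nonneg t)]
            have habs0 : 0 < |t| := lt_trans hT0 hIII
            rw [div_div, div_le_div_iff₀ (by positivity) (by positivity), h1]
            have := mul_le_mul_of_nonneg_left h2 hB₃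
            nlinarith
          calc ‖kernelIntegrand x α y A t‖ = ‖smoothZetaC ((α : ℂ) + t * I) y‖ / smoothZeta α y * ‖A t‖ := hnorm
            _ ≤ 1 * (B₃ / |t| ^ 3) := mul_le_mul hratio1 hAt (norm_nonneg _) zero_le_one
            _ ≤ (2 * B₃ / T) / (T ^ 2 + t ^ 2) := by rw [one_mul]; exact hden
            _ ≤ C / (T ^ 2 + t ^ 2) := by
                apply div_le_div_of_nonneg_right _ (by positivity)
                rw [hC]; have : 0 ≤ 2 * ε₂ * Ba * T ^ 2 := by positivity
                linarith
            _ ≤ A' * Real.exp (-(b / 10) * t ^ 2) + B / (α ^ 2 + t ^ 2) + C / (T ^ 2 + t ^ 2) := by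
                linarith [h3terms.1, h3terms.2.1]
  -- ### integrate the majorant
  have htail := norm_setIntegral_compl_le measurableSet_Icc (integrable_kernelIntegrand hα0 x y hA hAi)
    (by positivity : 0 < b / 10) hα0 hT0 hA'0 hB0' hC0 hmaj
  refine htail.trans ?_
  have hπ0 := Real.pi_pos
  have e1 : Real.pi / (b / 10) = 125 * Real.pi ^ 3 / φ := by
    rw [hb]; field_simp; ring
  have t2 : B * Real.pi / α ≤ 10 * Real.pi * ε₁ * B₀ / α := by
    have hB' : B ≤ 10 * ε₁ * B₀ := by
      rw [hB]
      have : α ^ 2 ≤ 1 := by nlinarith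
      have h0 : 0 ≤ ε₁ * B₀ := by positivity
      nlinarith
    calc B * Real.pi / α ≤ (10 * ε₁ * B₀) * Real.pi / α := by
          apply div_le_div_of_nonneg_right _ hα0.le
          exact mul_le_mul_of_nonneg_right hB' hπ0.le
      _ = 10 * Real.pi * ε₁ * B₀ / α := by ring
  have t3 : C * Real.pi / T = 2 * Real.pi * ε₂ * Ba * T + 2 * Real.pi * B₃ / T ^ 2 := by
    rw [hC]; field_simp
  rw [e1, t3]
  linarith [t2]

/-! ### Assembly -/

set_option maxHeartbeats 1000000 in
/-- **The saddle point with an abstract kernel and a parametric window.** Under the hypotheses of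
`norm_windowIntegral_sub_le` (at `τ = W/√φ`) and `norm_tailIntegral_le_window`:
`‖∫ f_A − A(0)√(2π/φ)‖ ≤ (1475 B₀ log y + 4B₁)/φ + ‖A 0‖ e^{−W²/4} √(4π/φ) + B₀ e^{−W²/140} √(125π³/φ)`
`+ 10πε₁B₀/α + 2πε₂B_aT + 2πB₃/T²` (`W = 100`: `norm_kernelIntegral_sub_main_le`).
[cite: HildebrandTenenbaum1986, §4 (Lemmas 10–11)] -/
theorem norm_kernelIntegral_sub_main_le_window {x T ε₁ ε₂ B₀ B₁ Ba B₃ W : ℝ} {y : ℕ} {A : ℝ → ℂ}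
    (hx : 1 < x) (hy : 2 ≤ y) (hα : 3 / 5 ≤ saddlePoint x y) (hα1 : saddlePoint x y ≤ 1)
    (hφ0 : 0 < saddlePhi₂ (saddlePoint x y) y) (hW : 0 < W)
    (hτ : W / Real.sqrt (saddlePhi₂ (saddlePoint x y) y) ≤ Real.pi / Real.log y)
    (hy1 : Real.pi / Real.log y ≤ 1)
    (hη : 13 * (W / Real.sqrt (saddlePhi₂ (saddlePoint x y) y)) ^ 3 * Real.log y *
      saddlePhi₂ (saddlePoint x y) y ≤ 1)
    (hT : 3 ≤ T) (hε₁ : 0 ≤ ε₁) (hε₂ : 0 ≤ ε₂)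
    (hdec1 : ∀ t : ℝ, Real.pi / Real.log y ≤ |t| → |t| ≤ 3 →
      ‖smoothZetaC ((saddlePoint x y : ℂ) + t * I) y‖ / smoothZeta (saddlePoint x y) y ≤ ε₁)
    (hdec2 : ∀ t : ℝ, 3 ≤ |t| → |t| ≤ T →
      ‖smoothZetaC ((saddlePoint x y : ℂ) + t * I) y‖ / smoothZeta (saddlePoint x y) y ≤ ε₂)
    (hA : Continuous A) (hAi : Integrable A) (hB₀ : 0 ≤ B₀) (hB₁ : 0 ≤ B₁) (hBa : 0 ≤ Ba) (hB₃ : 0 ≤ B₃)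
    (hB0 : ∀ t : ℝ, |t| ≤ 3 → ‖A t‖ ≤ B₀) (hB1 : ∀ t : ℝ, |t| ≤ 1 → ‖A t - A 0‖ ≤ B₁ * |t|)
    (hBall : ∀ t : ℝ, ‖A t‖ ≤ Ba) (hB3 : ∀ t : ℝ, T < |t| → ‖A t‖ ≤ B₃ / |t| ^ 3) :
    ‖(∫ t, kernelIntegrand x (saddlePoint x y) y A t) -
        A 0 * (Real.sqrt (2 * Real.pi / saddlePhi₂ (saddlePoint x y) y) : ℂ)‖ ≤
      (1475 * B₀ * Real.log y + 4 * B₁) / saddlePhi₂ (saddlePoint x y) y +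
        ‖A 0‖ * (Real.exp (-(W ^ 2 / 4)) * Real.sqrt (4 * Real.pi / saddlePhi₂ (saddlePoint x y) y)) +
        (B₀ * Real.exp (-(W ^ 2 / 140)) * Real.sqrt (125 * Real.pi ^ 3 / saddlePhi₂ (saddlePoint x y) y) +
          10 * Real.pi * ε₁ * B₀ / saddlePoint x y + 2 * Real.pi * ε₂ * Ba * T + 2 * Real.pi * B₃ / T ^ 2) := by
  set α : ℝ := saddlePoint x y with hαdef
  have hα0 : 0 < α := by linarith
  set φ : ℝ := saddlePhi₂ α y with hφ
  set Φ : ℝ := Real.sqrt φ with hΦ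
  have hΦ0 : 0 < Φ := Real.sqrt_pos.mpr hφ0
  have hΦsq : Φ ^ 2 = φ := Real.sq_sqrt hφ0.le
  set τ : ℝ := W / Φ with hτdef
  have hτ0 : 0 < τ := by positivity
  have hτ1 : τ ≤ 1 := hτ.trans hy1
  have hτsq : -(φ / 4) * τ ^ 2 = -(W ^ 2 / 4) := by
    rw [hτdef, div_pow, hΦsq]; field_simp
  have hf : Integrable (kernelIntegrand x α y A) := integrable_kernelIntegrand hα0 x y hA hAi
  have hsplit : ∫ t, kernelIntegrand x α y A t =
      (∫ t in Icc (-τ) τ, kernelIntegrand x α y A t) + ∫ t in (Icc (-τ) τ)ᶜ, kernelIntegrand x α y A t :=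
    (integral_add_compl measurableSet_Icc hf).symm
  have hwin := norm_windowIntegral_sub_le hx hy hα hτ1 hη hφ0 hA hAi hB₀ hB₁
    (fun t ht => hB0 t (ht.trans (by norm_num))) hB1
  have htail := norm_tailIntegral_le_window hy hα hα1 hφ0 hW hτ hy1 hT hε₁ hε₂ hdec1 hdec2 hA hAi hB₀ hBa hB₃
    hB0 hBall hB3
  obtain ⟨hG0, hG1⟩ := gaussian_window hφ0 hτ0.le
  rw [hτsq] at hG1
  rw [← hφ] at hwin htail
  rw [← hΦ] at htail
  rw [← hτdef] at htail
  set Gτ : ℝ := ∫ t in Icc (-τ) τ, Real.exp (-(φ / 2) * t ^ 2) with hGτ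
  have hGτC : (∫ t in Icc (-τ) τ, (Real.exp (-(φ / 2) * t ^ 2) : ℂ)) = (Gτ : ℂ) := by
    rw [hGτ]; exact integral_ofReal
  rw [hGτC] at hwin
  rw [hsplit]
  set Wi := ∫ t in Icc (-τ) τ, kernelIntegrand x α y A t with hWi
  set Tl := ∫ t in (Icc (-τ) τ)ᶜ, kernelIntegrand x α y A t with hTl
  have halg : Wi + Tl - A 0 * (Real.sqrt (2 * Real.pi / φ) : ℂ) =
      (Wi - A 0 * (Gτ : ℂ)) + A 0 * (((Gτ - Real.sqrt (2 * Real.pi / φ) : ℝ)) : ℂ) + Tl := by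
    push_cast; ring
  rw [halg]
  have hmid : ‖A 0 * (((Gτ - Real.sqrt (2 * Real.pi / φ) : ℝ)) : ℂ)‖ ≤
      ‖A 0‖ * (Real.exp (-(W ^ 2 / 4)) * Real.sqrt (4 * Real.pi / φ)) := by
    rw [norm_mul, Complex.norm_real, Real.norm_eq_abs, abs_sub_comm, abs_of_nonneg hG0]
    exact mul_le_mul_of_nonneg_left hG1 (norm_nonneg _)
  calc ‖(Wi - A 0 * (Gτ : ℂ)) + A 0 * (((Gτ - Real.sqrt (2 * Real.pi / φ) : ℝ)) : ℂ) + Tl‖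
      ≤ ‖Wi - A 0 * (Gτ : ℂ)‖ + ‖A 0 * (((Gτ - Real.sqrt (2 * Real.pi / φ) : ℝ)) : ℂ)‖ + ‖Tl‖ := norm_add₃_le
    _ ≤ _ := add_le_add (add_le_add hwin hmid) htail

/-! ### Choosing the window: two elementary inequalities -/

/-- **The floors are small for a wide window**: if `W ≥ 100` and `Wδ ≥ 80` (`δ > 0`) then
`2 e^{−W²/4} √(4π) + 2 e^{−W²/140} √(125π³) ≤ (5/2) δ` (both Gaussians are `≤ e^{−W²/140} ≤ 140/W²`).
[folklore] -/
theorem window_floor_le {δ W : ℝ} (hδ : 0 < δ) (hW : 100 ≤ W) (hWδ : 80 ≤ W * δ) :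
    2 * Real.exp (-(W ^ 2 / 4)) * Real.sqrt (4 * Real.pi) +
      2 * Real.exp (-(W ^ 2 / 140)) * Real.sqrt (125 * Real.pi ^ 3) ≤ 5 / 2 * δ := by
  have hπ4 := Real.pi_lt_d4
  have hπ0 := Real.pi_pos
  have hs4 : Real.sqrt (4 * Real.pi) ≤ 4 := by
    rw [Real.sqrt_le_left (by norm_num)]; nlinarith only [hπ4]
  have hs125 : Real.sqrt (125 * Real.pi ^ 3) ≤ 63 := by
    rw [Real.sqrt_le_left (by norm_num)]
    have : Real.pi ^ 3 ≤ 3.1416 ^ 3 := pow_le_pow_left₀ hπ0.le hπ4.le 3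
    nlinarith only [this]
  have hW0 : 0 < W := by linarith only [hW]
  have he1 : Real.exp (-(W ^ 2 / 4)) ≤ Real.exp (-(W ^ 2 / 140)) :=
    Real.exp_le_exp.2 (by nlinarith only [sq_nonneg W])
  -- `e^{-z} ≤ 1/(1+z) ≤ 1/z`
  have he2 : Real.exp (-(W ^ 2 / 140)) ≤ 140 / W ^ 2 := by
    have h1 := Real.add_one_le_exp (W ^ 2 / 140)
    have h2 : 0 < Real.exp (W ^ 2 / 140) := Real.exp_pos _
    rw [Real.exp_neg, inv_eq_one_div, div_le_div_iff₀ h2 (by positivity)]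
    nlinarith only [h1, sq_nonneg W]
  have hW2δ : 8000 ≤ W ^ 2 * δ := by
    have h1 : 100 * (W * δ) ≤ W * (W * δ) := mul_le_mul_of_nonneg_right hW (by positivity)
    nlinarith only [h1, hWδ]
  have e0 := Real.exp_pos (-(W ^ 2 / 4))
  have e140 := Real.exp_pos (-(W ^ 2 / 140))
  calc 2 * Real.exp (-(W ^ 2 / 4)) * Real.sqrt (4 * Real.pi) +
        2 * Real.exp (-(W ^ 2 / 140)) * Real.sqrt (125 * Real.pi ^ 3)
      ≤ 2 * Real.exp (-(W ^ 2 / 140)) * 4 + 2 * Real.exp (-(W ^ 2 / 140)) * 63 :=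
        add_le_add (mul_le_mul (mul_le_mul_of_nonneg_left he1 (by norm_num)) hs4 (Real.sqrt_nonneg _)
          (by positivity)) (mul_le_mul_of_nonneg_left hs125 (by positivity))
    _ = 134 * Real.exp (-(W ^ 2 / 140)) := by ring
    _ ≤ 134 * (140 / W ^ 2) := mul_le_mul_of_nonneg_left he2 (by norm_num)
    _ ≤ 5 / 2 * δ := by
        rw [← mul_div_assoc, div_le_iff₀ (by positivity)]
        nlinarith only [hW2δ]

/-- **The window hypotheses in terms of `W`**: if `c > 0`, `W ≥ 1`, `ℓ > 0`, `r > 0`, `ℓ ≤ r`,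
`c (L ℓ) ≤ φ` with `L = r⁵`, and `169 W⁶/c ≤ r⁴`, then `φ > 0`, `W/√φ ≤ π/ℓ` and `13 (W/√φ)³ ℓ φ ≤ 1`
(both follow from `13 W³ ℓ ≤ √φ`). With `L = log x`, `ℓ = log y`, `φ = φ₂(α,y)` these are the window
hypotheses of `norm_kernelIntegral_sub_main_le_window`. [folklore] -/
theorem window_range {c L ℓ r W φ : ℝ} (hc : 0 < c) (hW : 1 ≤ W) (hℓ : 0 < ℓ) (hr : 0 < r)
    (hr5 : r ^ 5 = L) (hℓr : ℓ ≤ r) (hφlo : c * (L * ℓ) ≤ φ) (hQ : 169 * W ^ 6 / c ≤ r ^ 4) :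
    0 < φ ∧ W / Real.sqrt φ ≤ Real.pi / ℓ ∧ 13 * (W / Real.sqrt φ) ^ 3 * ℓ * φ ≤ 1 := by
  have h1 : 169 * W ^ 6 ≤ r ^ 4 * c := by rwa [div_le_iff₀ hc] at hQ
  have h2 : r ^ 4 * ℓ ≤ L := by
    calc r ^ 4 * ℓ ≤ r ^ 4 * r := mul_le_mul_of_nonneg_left hℓr (by positivity)
      _ = L := by rw [← hr5]; ring
  have h3 : (13 * W ^ 3 * ℓ) ^ 2 ≤ φ := by
    have h4 : 169 * W ^ 6 * ℓ ≤ c * L := by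
      calc 169 * W ^ 6 * ℓ ≤ r ^ 4 * c * ℓ := mul_le_mul_of_nonneg_right h1 hℓ.le
        _ = c * (r ^ 4 * ℓ) := by ring
        _ ≤ c * L := mul_le_mul_of_nonneg_left h2 hc.le
    have h5 := mul_le_mul_of_nonneg_right h4 hℓ.le
    calc (13 * W ^ 3 * ℓ) ^ 2 = 169 * W ^ 6 * ℓ * ℓ := by ring
      _ ≤ c * L * ℓ := h5
      _ = c * (L * ℓ) := by ring
      _ ≤ φ := hφlo
  have hW0 : 0 < W := by linarith only [hW]
  have hWℓ : 0 < 13 * W ^ 3 * ℓ := by positivity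
  have hφ0 : 0 < φ := lt_of_lt_of_le (by positivity) h3
  set Φ := Real.sqrt φ with hΦ
  have hΦ0 : 0 < Φ := Real.sqrt_pos.2 hφ0
  have hΦsq : Φ ^ 2 = φ := Real.sq_sqrt hφ0.le
  have h6 : 13 * W ^ 3 * ℓ ≤ Φ := by
    rw [hΦ, Real.le_sqrt hWℓ.le hφ0.le]; exact h3
  have hW3 : W ≤ W ^ 3 := by
    have := pow_le_pow_right₀ hW (by norm_num : 1 ≤ 3); rwa [pow_one] at this
  refine ⟨hφ0, ?_, ?_⟩
  · rw [div_le_div_iff₀ hΦ0 hℓ]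
    have hπ := Real.pi_gt_three
    have h7 : W * ℓ ≤ 13 * W ^ 3 * ℓ := by
      apply mul_le_mul_of_nonneg_right _ hℓ.le; nlinarith only [hW3, hW0]
    nlinarith only [h6, h7, hΦ0, hπ]
  · have h8 : 13 * (W / Φ) ^ 3 * ℓ * φ = 13 * W ^ 3 * ℓ / Φ := by
      rw [div_pow, ← hΦsq]; field_simp
    rw [h8, div_le_one hΦ0]
    exact h6

end SaddleKernel

end Literature.NumberTheory.Sieve

end
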